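import Mathlib
import Summits.KontsevichZagierPeriods.Zeta5Search.DenomLaw.RaiseLineRung
import HarnessLib

/-!
# ζ(5) search — TRACK «DENOM-LAW» D1: the RAISE-LINE rung as one decidable guard (census-ladder form)

Cell `pub-zeta5` (HONEST FRAMING: systematic search; no irrationality claim unless certified), seat denom-prover-d1 generation 9
(`HOME/denom-law/prover-d1/ATTEMPT-9.md`).  Sequel of `DenomLaw/RaiseLineRung`: the hypotheses of `casLB_succ_le_of_raiseLine` (odd `N ≥ 3`,
palindromic list `T`, regime H0 at depth `N` attained by a multipole class, every deep class multipole with type list a single raise of `T` or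
the odd-centre class with list `T`) as ONE Boolean `raiseLineGuard b p N T` (evaluable by `decide` / `#eval` per cell, like census g17's
`ccGuard`), and the licence `casLB_succ_le_of_raiseLineGuard`.  Kernel evaluations (ATTEMPT-9 §2bis): `true` at `N = 9` with `T` the base
type (`[-5,-5]`, resp. `[1,-6,-6,1]`) on every exact `s₀ = 3` cell of the three open R2 digit types a=0 (3)ᴰ, a=1 (2)ᴰ, a=3 ∅ at `p = 11, 13`
(chambers without centre, centre alone, centre co-dominant), where `casLB = −15` and the observed valuation is `−14 = casLB + 1` (R2).
`p`-adic valuations of explicit rationals; nothing about ζ(5); no γ; records in print UNMOVED.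
-/

noncomputable section

open Finset

namespace Summit.KontsevichZagierPeriods.Zeta5Search.DenomLaw.RaiseLine

open Summit.KontsevichZagierPeriods.Zeta5Search.CasoratianValuation (InPolytope shift casoratian)
open Summit.KontsevichZagierPeriods.Zeta5Search.WedgeDictionary (dOf)
open Summit.KontsevichZagierPeriods.Zeta5Search.ClusterValuation
open Summit.KontsevichZagierPeriods.Zeta5Search.SecondOrder (classTypeList isRaise)

/-! ## §1  The guard and its licence -/

/-- RAISE-LINE GUARD: odd `N ≥ 3`, palindromic `T`, regime H0 at depth `N` attained by a multipole class, and every deep class multipole with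
type list a single raise of `T` or the odd-centre class with list `T`. -/
def raiseLineGuard (b : ℕ → ℤ) (p N : ℕ) (T : List ℤ) : Bool :=
  decide (3 ≤ N) && (N % 2 == 1) && (T.reverse == T) &&
    decide (∀ x ∈ range p, -(N : ℤ) ≤ classExp b p x) &&
    decide (∃ x ∈ multipoleClasses b p, classExp b p x = -(N : ℤ)) &&
    decide (∀ x ∈ deepClasses b p N, 2 ≤ classPoleCount b p x ∧
      (isRaise T (classTypeList b p x) = true ∨ (¬ (2 : ℤ) ∣ b 0 ∧ CentreIn b p x ∧ classTypeList b p x = T)))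

/-- **Raise-line licence**: `raiseLineGuard b p N T = true` gives `casLB + 1 ≤ v_p(Cas_j(b))` in the window. -/
theorem casLB_succ_le_of_raiseLineGuard (b : ℕ → ℤ) (p j N : ℕ) (T : List ℤ) (hb : InPolytope b) (hb' : InPolytope (shift b j))
    (hj1 : 1 ≤ j) (hj7 : j ≤ 7) (hprime : p.Prime) (hp5 : 5 ≤ p) (hpb : (p : ℤ) ≤ b 0) (hpd : (p : ℤ) ≤ dOf b)
    (hwin : (b 0 + 2 : ℤ) < (p : ℤ) ^ 2) (H : raiseLineGuard b p N T = true) (hcas : casoratian b j ≠ 0) :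
    casLB b p + 1 ≤ padicValRat p (casoratian b j) := by
  haveI : Fact p.Prime := ⟨hprime⟩
  have H' := H
  simp only [raiseLineGuard, Bool.and_eq_true, decide_eq_true_eq, beq_iff_eq] at H'
  obtain ⟨⟨⟨⟨⟨hN3, hodd⟩, hT⟩, hH0⟩, hM⟩, hdeep⟩ := H'
  exact casLB_succ_le_of_raiseLine b hb hp5 hpb hwin hN3 hodd hT hdeep hb' hj1 hj7 hpd
    (fun x hx => hH0 x (mem_range.2 hx)) hM hcas

end Summit.KontsevichZagierPeriods.Zeta5Search.DenomLaw.RaiseLine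

end
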